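import Summits.RiemannHypothesis.RiemannHypothesis.Theorems.TiltedLandingLaw421R3MenuThinNF
import Summits.RiemannHypothesis.RiemannHypothesis.Theorems.TiltedLandingLaw421R3SinkConePos

/-!
# W-09 E5 token «ARemBox» — the A-side box lemma `J ≤ 9/2` on the thin boundary (C3 rh-idea-3 g59; image v1)

Imports: #1311 `…R3MenuThinNF` (kernels `pairReForm`/`pairCForm`, `pairReForm_zero`, `pairReForm_eq`) and `…R3SinkConePos`
(`pairCForm_mul`, `pairDenom_pos_sub/add`).  Namespace `RhW08.ARemBox`.  Supports ⟨stmt-RiemannHypothesis-27010⟩ as a helper of the E5 leaf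
(`RhW08.MenuThinNF.MenuThinCertFormSig (√5/2) (27/256)`): it proves, for every legal NF datum and every `u = ξ + ib` on the thin boundary
(columns `ξ = ±1`, `0 ≤ b ≤ 1 − h`; lid `b = 1 − h`, `|ξ| ≥ 1`),

  `-(t * (pairReForm δ t ξ b − pairReForm 0 t ξ b)) ≤ 9/2 * δ * pairCForm δ t ξ b`   (`t·(Re K_u(p₀) − Re K_u(w)) ≤ (9/2)·δ·c_u(w)`),

i.e. the four-clause family that is `RhW08.MenuThinTop.JBoundOn (9/2) h δ t` (#1323) with `OnThinBdry` unfolded (`jBound_core`: hypotheses only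
`0 < t`, `0 ≤ δ`, `2δ ≤ h ≤ 1`; `jBound_92`: under the exact NF binders, `2δ ≤ h` from `δ² < (Y−t)(Y+t) < (s/4)(2h) ≤ h²/4`), and the same family
in the `|ξ| ≥ 1` lid spelling (`ARemSig (9/2)`, `aRemSig_92`).

Route — pure algebra, no mean-value theorem: the EXACT identity
`pairReForm 0 t ξ b − pairReForm δ t ξ b = δ·(N₁·C_w·C₀ + N₂·A_w·A₀)/(A₀C₀A_wC_w)` (`N₁ = ξ(ξ−δ) − (t−b)²`, `N₂ = ξ(ξ−δ) − (t+b)²`,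
`A₀,C₀ = ξ² + (t∓b)²`, `A_w,C_w = (δ−ξ)² + (t∓b)²`) together with `pairCForm·A_w·C_w = 2t·cn_w` turns the point bound into ONE degree-6
polynomial inequality `N₁C_wC₀ + N₂A_wA₀ ≤ 9·cn_w·A₀C₀` (`aPoint`), whose slack is `S₀ − δ·ξ·B₁ + δ²·S₂ + δ³·S₃`; on the near side
(`ξ ≥ 1`, `2δ ≤ h ≤ ξ − b`) the linear loss is absorbed by `S₀` with an explicit nonnegative decomposition (`slack_near`), on the far side
(`ξ ≤ −1`, `2δ ≤ 1`) every grouped term is nonnegative (`slack_far`).  Numerically sup J = 1.515 over legal data (margin ×3).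

Nothing here bears on the truth of RH; RH is not proved; the leaf, `ReducedLeaf3Sig` and ⟨27010⟩ stay open.  0 sorry.
-/

noncomputable section

namespace RhW08.ARemBox

open RhW08.SinkBdry RhW08.SinkConePos

/-! ## §1 The polynomial slack -/

/-- NEAR side (`ξ ≥ 1`, `0 ≤ b ≤ ξ`, `0 ≤ 2δ ≤ ξ − b`): the degree-6 inequality `N₁C_wC₀ + N₂A_wA₀ ≤ 9·cn_w·A₀·C₀`. -/
theorem slack_near {δ t ξ b : ℝ} (hξ : 1 ≤ ξ) (hb : 0 ≤ b) (hbξ : b ≤ ξ) (hδ : 0 ≤ δ) (hδ2 : 2 * δ ≤ ξ - b) :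
    (ξ * (ξ - δ) - (t - b) ^ 2) * ((δ - ξ) ^ 2 + (t + b) ^ 2) * (ξ ^ 2 + (t + b) ^ 2) +
        (ξ * (ξ - δ) - (t + b) ^ 2) * ((δ - ξ) ^ 2 + (t - b) ^ 2) * (ξ ^ 2 + (t - b) ^ 2) ≤
      9 * ((δ - ξ) ^ 2 + t ^ 2 - b ^ 2) * (ξ ^ 2 + (t - b) ^ 2) * (ξ ^ 2 + (t + b) ^ 2) := by
  have hξ0 : 0 ≤ ξ := by linarith
  have key : 9 * ((δ - ξ) ^ 2 + t ^ 2 - b ^ 2) * (ξ ^ 2 + (t - b) ^ 2) * (ξ ^ 2 + (t + b) ^ 2) -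
      ((ξ * (ξ - δ) - (t - b) ^ 2) * ((δ - ξ) ^ 2 + (t + b) ^ 2) * (ξ ^ 2 + (t + b) ^ 2) +
        (ξ * (ξ - δ) - (t + b) ^ 2) * ((δ - ξ) ^ 2 + (t - b) ^ 2) * (ξ ^ 2 + (t - b) ^ 2)) =
      (ξ - b) * (ξ ^ 5 + ξ ^ 3 * b * (7 * ξ - 2 * b) + ξ * b ^ 3 * (14 * ξ - 3 * b) + 7 * b ^ 5)
        + t ^ 2 * ((5 * b ^ 2 - 3 * ξ ^ 2) ^ 2 + 8 * ξ ^ 2 * b * (2 * ξ - b))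
        + t ^ 4 * ((ξ - b) * (19 * ξ + 29 * b)) + 11 * t ^ 6
        + ((ξ - b) / 2 - δ) * ξ * (12 * ξ ^ 4 + 32 * ξ ^ 2 * b ^ 2 + 20 * b ^ 4 + 32 * t ^ 2 * ξ ^ 2 + 20 * t ^ 4)
        + 56 * δ * ξ * t ^ 2 * b ^ 2
        + δ ^ 2 * (11 * (b ^ 2 - t ^ 2) ^ 2 + 14 * ξ ^ 2 * (b ^ 2 + t ^ 2) + 3 * ξ ^ 4)
        + δ ^ 3 * (2 * ξ * (ξ ^ 2 + b ^ 2 + t ^ 2)) := by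
    ring
  have hA : 0 ≤ ξ ^ 3 * b * (7 * ξ - 2 * b) := mul_nonneg (mul_nonneg (pow_nonneg hξ0 3) hb) (by linarith)
  have hB : 0 ≤ ξ * b ^ 3 * (14 * ξ - 3 * b) := mul_nonneg (mul_nonneg hξ0 (pow_nonneg hb 3)) (by linarith)
  have h1 : 0 ≤ (ξ - b) * (ξ ^ 5 + ξ ^ 3 * b * (7 * ξ - 2 * b) + ξ * b ^ 3 * (14 * ξ - 3 * b) + 7 * b ^ 5) := by
    apply mul_nonneg (by linarith)
    have := pow_nonneg hξ0 5
    have := pow_nonneg hb 5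
    linarith
  have h2 : 0 ≤ t ^ 2 * ((5 * b ^ 2 - 3 * ξ ^ 2) ^ 2 + 8 * ξ ^ 2 * b * (2 * ξ - b)) :=
    mul_nonneg (sq_nonneg t) (add_nonneg (sq_nonneg _)
      (mul_nonneg (mul_nonneg (mul_nonneg (by norm_num) (sq_nonneg ξ)) hb) (by linarith)))
  have h3 : 0 ≤ t ^ 4 * ((ξ - b) * (19 * ξ + 29 * b)) := by
    have : 0 ≤ t ^ 4 := by positivity
    exact mul_nonneg this (mul_nonneg (by linarith) (by linarith))
  have h4 : 0 ≤ 11 * t ^ 6 := by positivity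
  have h5 : 0 ≤ ((ξ - b) / 2 - δ) * ξ * (12 * ξ ^ 4 + 32 * ξ ^ 2 * b ^ 2 + 20 * b ^ 4 + 32 * t ^ 2 * ξ ^ 2 + 20 * t ^ 4) :=
    mul_nonneg (mul_nonneg (by linarith) hξ0) (by positivity)
  have h6 : 0 ≤ 56 * δ * ξ * t ^ 2 * b ^ 2 := by positivity
  have h7 : 0 ≤ δ ^ 2 * (11 * (b ^ 2 - t ^ 2) ^ 2 + 14 * ξ ^ 2 * (b ^ 2 + t ^ 2) + 3 * ξ ^ 4) := by positivity
  have h8 : 0 ≤ δ ^ 3 * (2 * ξ * (ξ ^ 2 + b ^ 2 + t ^ 2)) := by positivity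
  linarith [key, h1, h2, h3, h4, h5, h6, h7, h8]

/-- FAR side (`ξ ≤ −1`, `0 ≤ b ≤ −ξ`, `0 ≤ 2δ ≤ 1`): the same inequality; every grouped term of the slack is nonnegative. -/
theorem slack_far {δ t ξ b : ℝ} (hξ : ξ ≤ -1) (hb : 0 ≤ b) (hbξ : b ≤ -ξ) (hδ : 0 ≤ δ) (hδ1 : 2 * δ ≤ 1) :
    (ξ * (ξ - δ) - (t - b) ^ 2) * ((δ - ξ) ^ 2 + (t + b) ^ 2) * (ξ ^ 2 + (t + b) ^ 2) +
        (ξ * (ξ - δ) - (t + b) ^ 2) * ((δ - ξ) ^ 2 + (t - b) ^ 2) * (ξ ^ 2 + (t - b) ^ 2) ≤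
      9 * ((δ - ξ) ^ 2 + t ^ 2 - b ^ 2) * (ξ ^ 2 + (t - b) ^ 2) * (ξ ^ 2 + (t + b) ^ 2) := by
  have hz : 0 ≤ -ξ := by linarith
  have hξb : 0 ≤ ξ ^ 2 - b ^ 2 := by nlinarith [mul_nonneg (by linarith : 0 ≤ -ξ - b) (by linarith : 0 ≤ -ξ + b)]
  have h2ξb : 0 ≤ 2 * ξ ^ 2 - b ^ 2 := by nlinarith [sq_nonneg ξ]
  have key : 9 * ((δ - ξ) ^ 2 + t ^ 2 - b ^ 2) * (ξ ^ 2 + (t - b) ^ 2) * (ξ ^ 2 + (t + b) ^ 2) -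
      ((ξ * (ξ - δ) - (t - b) ^ 2) * ((δ - ξ) ^ 2 + (t + b) ^ 2) * (ξ ^ 2 + (t + b) ^ 2) +
        (ξ * (ξ - δ) - (t + b) ^ 2) * ((δ - ξ) ^ 2 + (t - b) ^ 2) * (ξ ^ 2 + (t - b) ^ 2)) =
      (7 * (ξ ^ 2 - b ^ 2) * (ξ ^ 2 + b ^ 2) ^ 2 + t ^ 2 * (25 * (ξ ^ 2 - b ^ 2) ^ 2 + 12 * ξ ^ 2 * b ^ 2)
          + 29 * t ^ 4 * (ξ ^ 2 - b ^ 2) + 11 * t ^ 6)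
        + δ * (-ξ) * (12 * ξ ^ 4 + 32 * ξ ^ 2 * b ^ 2 + 16 * t ^ 2 * (2 * ξ ^ 2 - b ^ 2) + 20 * (b ^ 2 - t ^ 2) ^ 2)
        + δ ^ 2 * ((11 * (b ^ 2 - t ^ 2) ^ 2 + 14 * ξ ^ 2 * (b ^ 2 + t ^ 2) + 3 * ξ ^ 4)
          + 2 * δ * ξ * (ξ ^ 2 + b ^ 2 + t ^ 2)) := by
    ring
  have h1 : 0 ≤ 7 * (ξ ^ 2 - b ^ 2) * (ξ ^ 2 + b ^ 2) ^ 2 + t ^ 2 * (25 * (ξ ^ 2 - b ^ 2) ^ 2 + 12 * ξ ^ 2 * b ^ 2)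
      + 29 * t ^ 4 * (ξ ^ 2 - b ^ 2) + 11 * t ^ 6 := by positivity
  have h2 : 0 ≤ δ * (-ξ) * (12 * ξ ^ 4 + 32 * ξ ^ 2 * b ^ 2 + 16 * t ^ 2 * (2 * ξ ^ 2 - b ^ 2) + 20 * (b ^ 2 - t ^ 2) ^ 2) :=
    mul_nonneg (mul_nonneg hδ hz) (by positivity)
  have h3 : 0 ≤ δ ^ 2 * ((11 * (b ^ 2 - t ^ 2) ^ 2 + 14 * ξ ^ 2 * (b ^ 2 + t ^ 2) + 3 * ξ ^ 4)
      + 2 * δ * ξ * (ξ ^ 2 + b ^ 2 + t ^ 2)) := by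
    apply mul_nonneg (sq_nonneg δ)
    have hzz : 2 * δ * (-ξ) ≤ ξ ^ 2 := by nlinarith
    have hp : 0 ≤ ξ ^ 2 + b ^ 2 + t ^ 2 := by positivity
    have hm : 2 * δ * (-ξ) * (ξ ^ 2 + b ^ 2 + t ^ 2) ≤ ξ ^ 2 * (ξ ^ 2 + b ^ 2 + t ^ 2) := mul_le_mul_of_nonneg_right hzz hp
    have hq : 0 ≤ 11 * (b ^ 2 - t ^ 2) ^ 2 + 13 * ξ ^ 2 * (b ^ 2 + t ^ 2) + 2 * ξ ^ 4 := by positivity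
    nlinarith [hm, hq]
  linarith [key, h1, h2, h3]

/-! ## §2 From the polynomial inequality to the A-bound at a boundary point -/

/-- the exact identities `Re K_u(p₀) − Re K_u(w) = δ·L/(A₀C₀A_wC_w)` and `c_u(w) = 2t·cn_w/(A_wC_w)` reduce the pointwise A-bound
`t·(Re K_u(p₀) − Re K_u(w)) ≤ (9/2)·δ·c_u(w)` to `L ≤ 9·cn_w·A₀·C₀` (both cones strict: no pole). -/
theorem aPoint {δ t ξ b : ℝ} (ht : 0 < t) (hδ : 0 ≤ δ) (hw : b ^ 2 < (δ - ξ) ^ 2 + t ^ 2) (h0 : b ^ 2 < ξ ^ 2 + t ^ 2)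
    (hpoly : (ξ * (ξ - δ) - (t - b) ^ 2) * ((δ - ξ) ^ 2 + (t + b) ^ 2) * (ξ ^ 2 + (t + b) ^ 2) +
        (ξ * (ξ - δ) - (t + b) ^ 2) * ((δ - ξ) ^ 2 + (t - b) ^ 2) * (ξ ^ 2 + (t - b) ^ 2) ≤
      9 * ((δ - ξ) ^ 2 + t ^ 2 - b ^ 2) * (ξ ^ 2 + (t - b) ^ 2) * (ξ ^ 2 + (t + b) ^ 2)) :
    t * (pairReForm 0 t ξ b - pairReForm δ t ξ b) ≤ 9 / 2 * δ * pairCForm δ t ξ b := by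
  have hAw := pairDenom_pos_sub hw
  have hCw := pairDenom_pos_add hw
  have h0' : b ^ 2 < (0 - ξ) ^ 2 + t ^ 2 := by rw [zero_sub, neg_sq]; exact h0
  have hA0 : 0 < ξ ^ 2 + (t - b) ^ 2 := by have := pairDenom_pos_sub h0'; rw [zero_sub, neg_sq] at this; exact this
  have hC0 : 0 < ξ ^ 2 + (t + b) ^ 2 := by have := pairDenom_pos_add h0'; rw [zero_sub, neg_sq] at this; exact this
  have hD : 0 < (ξ ^ 2 + (t - b) ^ 2) * (ξ ^ 2 + (t + b) ^ 2) * (((δ - ξ) ^ 2 + (t - b) ^ 2) * ((δ - ξ) ^ 2 + (t + b) ^ 2)) :=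
    by positivity
  have eC : pairCForm δ t ξ b =
      2 * t * ((δ - ξ) ^ 2 + t ^ 2 - b ^ 2) / (((δ - ξ) ^ 2 + (t - b) ^ 2) * ((δ - ξ) ^ 2 + (t + b) ^ 2)) := by
    rw [eq_div_iff (mul_pos hAw hCw).ne']
    exact pairCForm_mul δ t ξ b hAw.ne' hCw.ne'
  have eR : pairReForm 0 t ξ b - pairReForm δ t ξ b =
      δ * ((ξ * (ξ - δ) - (t - b) ^ 2) * ((δ - ξ) ^ 2 + (t + b) ^ 2) * (ξ ^ 2 + (t + b) ^ 2) +
        (ξ * (ξ - δ) - (t + b) ^ 2) * ((δ - ξ) ^ 2 + (t - b) ^ 2) * (ξ ^ 2 + (t - b) ^ 2)) /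
      ((ξ ^ 2 + (t - b) ^ 2) * (ξ ^ 2 + (t + b) ^ 2) * (((δ - ξ) ^ 2 + (t - b) ^ 2) * ((δ - ξ) ^ 2 + (t + b) ^ 2))) := by
    rw [eq_div_iff hD.ne', pairReForm_zero, pairReForm_eq]
    field_simp
    ring
  have e1 : t * (pairReForm 0 t ξ b - pairReForm δ t ξ b) =
      t * δ * ((ξ * (ξ - δ) - (t - b) ^ 2) * ((δ - ξ) ^ 2 + (t + b) ^ 2) * (ξ ^ 2 + (t + b) ^ 2) +
        (ξ * (ξ - δ) - (t + b) ^ 2) * ((δ - ξ) ^ 2 + (t - b) ^ 2) * (ξ ^ 2 + (t - b) ^ 2)) /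
      ((ξ ^ 2 + (t - b) ^ 2) * (ξ ^ 2 + (t + b) ^ 2) * (((δ - ξ) ^ 2 + (t - b) ^ 2) * ((δ - ξ) ^ 2 + (t + b) ^ 2))) := by
    rw [eR]; ring
  have e2 : 9 / 2 * δ * pairCForm δ t ξ b =
      t * δ * (9 * ((δ - ξ) ^ 2 + t ^ 2 - b ^ 2) * (ξ ^ 2 + (t - b) ^ 2) * (ξ ^ 2 + (t + b) ^ 2)) /
      ((ξ ^ 2 + (t - b) ^ 2) * (ξ ^ 2 + (t + b) ^ 2) * (((δ - ξ) ^ 2 + (t - b) ^ 2) * ((δ - ξ) ^ 2 + (t + b) ^ 2))) := by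
    rw [eC, eq_div_iff hD.ne']
    field_simp
  rw [e1, e2]
  exact div_le_div_of_nonneg_right (mul_le_mul_of_nonneg_left hpoly (by positivity)) hD.le

/-- NEAR boundary point (`ξ ≥ 1`, `0 ≤ b ≤ 1 − h`) for a legal child (`0 ≤ δ`, `2δ ≤ h ≤ 1`, `0 < t`). -/
theorem aPoint_near {h δ t ξ b : ℝ} (hh : 0 < h) (ht : 0 < t) (hδ : 0 ≤ δ) (hδh : 2 * δ ≤ h)
    (hξ : 1 ≤ ξ) (hb : 0 ≤ b) (hb1 : b ≤ 1 - h) :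
    t * (pairReForm 0 t ξ b - pairReForm δ t ξ b) ≤ 9 / 2 * δ * pairCForm δ t ξ b := by
  have hbξ : b ≤ ξ := by linarith
  have hδ2 : 2 * δ ≤ ξ - b := by linarith
  have hw : b ^ 2 < (δ - ξ) ^ 2 + t ^ 2 := by
    nlinarith [mul_pos (by linarith : 0 < ξ - δ - b) (by linarith : 0 < ξ - δ + b), sq_nonneg t]
  have h0 : b ^ 2 < ξ ^ 2 + t ^ 2 := by
    nlinarith [mul_pos (by linarith : 0 < ξ - b) (by linarith : 0 < ξ + b), sq_nonneg t]
  exact aPoint ht hδ hw h0 (slack_near hξ hb hbξ hδ hδ2)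

/-- FAR boundary point (`ξ ≤ −1`, `0 ≤ b ≤ 1 − h`) for a legal child. -/
theorem aPoint_far {h δ t ξ b : ℝ} (hh : 0 < h) (hh1 : h ≤ 1) (ht : 0 < t) (hδ : 0 ≤ δ) (hδh : 2 * δ ≤ h)
    (hξ : 1 ≤ -ξ) (hb : 0 ≤ b) (hb1 : b ≤ 1 - h) :
    t * (pairReForm 0 t ξ b - pairReForm δ t ξ b) ≤ 9 / 2 * δ * pairCForm δ t ξ b := by
  have hbξ : b ≤ -ξ := by linarith
  have hw : b ^ 2 < (δ - ξ) ^ 2 + t ^ 2 := by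
    nlinarith [mul_pos (by linarith : 0 < δ - ξ - b) (by linarith : 0 < δ - ξ + b), sq_nonneg t]
  have h0 : b ^ 2 < ξ ^ 2 + t ^ 2 := by
    nlinarith [mul_pos (by linarith : 0 < -ξ - b) (by linarith : 0 < -ξ + b), sq_nonneg t]
  exact aPoint ht hδ hw h0 (slack_far (by linarith) hb hbξ hδ (by linarith))

/-! ## §3 The box lemma -/

/-- ★★ CORE: `J ≤ 9/2` on the whole thin boundary for `0 < t`, `0 ≤ δ`, `2δ ≤ h ≤ 1` — the four clauses of
`RhW08.MenuThinTop.JBoundOn (9/2) h δ t` with `OnThinBdry` unfolded (both unfold by `rfl`). -/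
theorem jBound_core {h δ t : ℝ} (hh : 0 < h) (hh1 : h ≤ 1) (ht : 0 < t) (hδ : 0 ≤ δ) (hδh : 2 * δ ≤ h) :
    (∀ b : ℝ, 0 ≤ b → b ≤ 1 - h → -(t * (pairReForm δ t 1 b - pairReForm 0 t 1 b)) ≤ 9 / 2 * δ * pairCForm δ t 1 b) ∧
    (∀ b : ℝ, 0 ≤ b → b ≤ 1 - h → -(t * (pairReForm δ t (-1) b - pairReForm 0 t (-1) b)) ≤ 9 / 2 * δ * pairCForm δ t (-1) b) ∧
    (∀ ξ : ℝ, 1 ≤ ξ → -(t * (pairReForm δ t ξ (1 - h) - pairReForm 0 t ξ (1 - h))) ≤ 9 / 2 * δ * pairCForm δ t ξ (1 - h)) ∧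
    (∀ ξ : ℝ, 1 ≤ -ξ → -(t * (pairReForm δ t ξ (1 - h) - pairReForm 0 t ξ (1 - h))) ≤ 9 / 2 * δ * pairCForm δ t ξ (1 - h)) := by
  refine ⟨fun b hb hb1 => ?_, fun b hb hb1 => ?_, fun ξ hξ => ?_, fun ξ hξ => ?_⟩
  · have := aPoint_near hh ht hδ hδh (le_refl (1 : ℝ)) hb hb1; linarith
  · have := aPoint_far hh hh1 ht hδ hδh (by norm_num : (1 : ℝ) ≤ -(-1)) hb hb1; linarith
  · have := aPoint_near hh ht hδ hδh hξ (by linarith : (0 : ℝ) ≤ 1 - h) le_rfl; linarith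
  · have := aPoint_far hh hh1 ht hδ hδh hξ (by linarith : (0 : ℝ) ≤ 1 - h) le_rfl; linarith

/-- ★★ `J ≤ 9/2` under the exact NF binders of `MenuThinCertFormSig` (the J-half of `UniformBoxesSig (9/2) g`; `2δ ≤ h` from
`δ² < Y² − t² < (s/4)·2h ≤ h²/4`). -/
theorem jBound_92 : ∀ (s h δ t Y : ℝ), 0 < s → 2 * s ≤ h → 3 * h < 2 → 0 < Y → Y ≤ h → 0 < t → t < Y → Y - s / 4 < t →
    δ ^ 2 + t ^ 2 < Y ^ 2 → 0 ≤ δ →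
    (∀ b : ℝ, 0 ≤ b → b ≤ 1 - h → -(t * (pairReForm δ t 1 b - pairReForm 0 t 1 b)) ≤ 9 / 2 * δ * pairCForm δ t 1 b) ∧
    (∀ b : ℝ, 0 ≤ b → b ≤ 1 - h → -(t * (pairReForm δ t (-1) b - pairReForm 0 t (-1) b)) ≤ 9 / 2 * δ * pairCForm δ t (-1) b) ∧
    (∀ ξ : ℝ, 1 ≤ ξ → -(t * (pairReForm δ t ξ (1 - h) - pairReForm 0 t ξ (1 - h))) ≤ 9 / 2 * δ * pairCForm δ t ξ (1 - h)) ∧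
    (∀ ξ : ℝ, 1 ≤ -ξ → -(t * (pairReForm δ t ξ (1 - h) - pairReForm 0 t ξ (1 - h))) ≤ 9 / 2 * δ * pairCForm δ t ξ (1 - h)) := by
  intro s h δ t Y hs hsh h3 hY hYh ht htY hdrop hnest hδ
  have hh : 0 < h := by linarith
  have hq : (Y - t) * (Y + t) ≤ s / 4 * (Y + t) := mul_le_mul_of_nonneg_right (by linarith) (by linarith)
  have hq' : s / 4 * (Y + t) ≤ h / 8 * (2 * h) := mul_le_mul (by linarith) (by linarith) (by linarith) (by linarith)
  have hδsq : δ ^ 2 < h ^ 2 / 4 := by nlinarith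
  have hδh : 2 * δ ≤ h := by
    by_contra hc
    have hc' := not_le.mp hc
    have := mul_pos (by linarith : (0 : ℝ) < 2 * δ - h) (by linarith : (0 : ℝ) < 2 * δ + h)
    nlinarith
  exact jBound_core hh (by linarith) ht hδ hδh

/-! ## §4 The `|ξ| ≥ 1` lid spelling (`ARemAt` / `ARemSig`) -/

/-- the flat A-remainder `t·(Re K_u(p₀) − Re K_u(w)) ≤ J0·δ·c_u(w)` at a boundary point. -/
def ARemAt (J0 δ t ξ b : ℝ) : Prop :=
  t * (pairReForm 0 t ξ b - pairReForm δ t ξ b) ≤ J0 * δ * pairCForm δ t ξ b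

/-- the flat A-remainder family on the thin boundary under the NF binders (columns as pairs, lid by `|ξ| ≥ 1`). -/
def ARemSig (J0 : ℝ) : Prop :=
  ∀ (s h δ t Y : ℝ), 0 < s → 2 * s ≤ h → 3 * h < 2 → 0 < Y → Y ≤ h → 0 < t → t < Y → Y - s / 4 < t →
    δ ^ 2 + t ^ 2 < Y ^ 2 → 0 ≤ δ →
    (∀ b : ℝ, 0 ≤ b → b ≤ 1 - h → ARemAt J0 δ t 1 b ∧ ARemAt J0 δ t (-1) b) ∧
    (∀ ξ : ℝ, 1 ≤ |ξ| → ARemAt J0 δ t ξ (1 - h))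

/-- ★★ `ARemSig (9/2)`. -/
theorem aRemSig_92 : ARemSig (9 / 2) := by
  intro s h δ t Y hs hsh h3 hY hYh ht htY hdrop hnest hδ
  obtain ⟨h1, h2, h3', h4⟩ := jBound_92 s h δ t Y hs hsh h3 hY hYh ht htY hdrop hnest hδ
  refine ⟨fun b hb hb1 => ⟨?_, ?_⟩, fun ξ hξ => ?_⟩
  · have := h1 b hb hb1; unfold ARemAt; linarith
  · have := h2 b hb hb1; unfold ARemAt; linarith
  · unfold ARemAt
    rcases le_or_gt 0 ξ with hξ0 | hξ0
    · rw [abs_of_nonneg hξ0] at hξ; have := h3' ξ hξ; linarith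
    · rw [abs_of_neg hξ0] at hξ; have := h4 ξ hξ; linarith

end RhW08.ARemBox

end
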